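import Summits.QuantumFields.QCD.Theorems.HeatSlicedQuarksAccretiveWilsonDirac
import Summits.QuantumFields.QCD.Theorems.HeatSlicedQuarksSmallFieldUltracontractivityStubHeatRowCalculus

/-!
# Stub `stub_infraredDecay` of line `Sketch`
(crux `Summit.QuantumFields.QCD.Theses.HeatSlicedQuarks.InterleavedHeatSliceFlow`, item stmt-QuantumFields-8891)

**Infrared decay of the heat remainder for positive bare mass.**  For every torus `L`, every
`SU(3)` lattice gauge field `U`, every bare mass `m > 0`, every proper time `T ≥ 0` and every pair of
site/colour/spin indices `ξ, η`,

  `|e^{-T·D_WᴴD_W}(ξ, η)| ≤ e^{-T m²}`,   `D_W = wilsonDirac (fundamentalRep (Fin 3)) U m 1`.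

Proof (spectral).  Wilson-term accretivity (item stmt-QuantumFields-8875, PROVED:
`accretiveWilsonDirac_proof`) gives `Re⟨v, D_W v⟩ = m‖v‖² + ½Σ‖U v(x+μ̂) − v(x)‖² ≥ m‖v‖²`, whence by
Cauchy–Schwarz `m‖v‖² ≤ |⟨v, D_W v⟩| ≤ ‖v‖ ‖D_W v‖`, i.e. `‖D_W v‖² ≥ m²‖v‖²` (`m ≥ 0`).  At a unit
eigenvector `u_k` of the positive matrix `H = D_WᴴD_W` this reads `λ_k = ⟨u_k, H u_k⟩ = ‖D_W u_k‖² ≥ m²`.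
In the eigenbasis, `e^{-TH} = U diag(e^{-Tλ_k}) U*` (`spectral_pair` of the landed heat-row calculus), so
`|e^{-TH}(ξ,η)| = |Σ_k U_{ξk} e^{-Tλ_k} conj U_{ηk}| ≤ e^{-Tm²} Σ_k |U_{ξk}| |U_{ηk}| ≤ e^{-Tm²}`
by AM–GM and the unit rows of the unitary `U`.  Finite-dimensional linear algebra plus the proved route item
8875; no unproved named facts are used. [folklore]
-/

noncomputable section

namespace Summit.QuantumFields.QCD.Cruxes.InterleavedHeatSliceFlow.Sketch

open Literature.MathematicalPhysics.QuantumLattice Literature.MathematicalPhysics.QuantumFieldTheory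
  Literature.Probability.LatticeModels
open Summit.QuantumFields.QCD.Theorems.SmallFieldUltracontractivity.Negative
open Summit.QuantumFields.QCD.Cruxes.SmallFieldUltracontractivity.PointCentredAxialParabolic.HeatRowCalculus
open scoped Matrix ComplexOrder

section Generic

variable {ι : Type*} [Fintype ι] [DecidableEq ι]

omit [DecidableEq ι] in
/-- **Accretive ⇒ coercive** (Cauchy–Schwarz): if `m Σ|v_i|² ≤ Re Σ conj(v_i) (A v)_i` with `m ≥ 0`,
then `m² Σ|v_i|² ≤ Σ |(A v)_i|²` (`m‖v‖² ≤ |⟨v, Av⟩| ≤ ‖v‖ ‖Av‖`, then square and cancel `‖v‖²`). -/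
theorem sq_mul_sum_norm_sq_le_of_accretive (A : Matrix ι ι ℂ) {m : ℝ} (hm : 0 ≤ m) (v : ι → ℂ)
    (hacc : m * ∑ i, ‖v i‖ ^ 2 ≤ (∑ i, star (v i) * (A *ᵥ v) i).re) :
    m ^ 2 * ∑ i, ‖v i‖ ^ 2 ≤ ∑ i, ‖(A *ᵥ v) i‖ ^ 2 := by
  -- `Re ⟨v, Av⟩ ≤ |⟨v, Av⟩| ≤ Σ |v_i| |(Av)_i|`
  have h2 : (∑ i, star (v i) * (A *ᵥ v) i).re ≤ ∑ i, ‖v i‖ * ‖(A *ᵥ v) i‖ := by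
    refine (Complex.re_le_norm _).trans ((norm_sum_le _ _).trans (le_of_eq ?_))
    refine Finset.sum_congr rfl fun i _ => ?_
    rw [norm_mul, norm_star]
  -- Cauchy–Schwarz `(Σ |v_i| |(Av)_i|)² ≤ (Σ |v_i|²) (Σ |(Av)_i|²)`
  have h3 : (∑ i, ‖v i‖ * ‖(A *ᵥ v) i‖) ^ 2 ≤ (∑ i, ‖v i‖ ^ 2) * ∑ i, ‖(A *ᵥ v) i‖ ^ 2 :=
    Finset.sum_mul_sq_le_sq_mul_sq _ _ _
  have ha : 0 ≤ ∑ i, ‖v i‖ ^ 2 := Finset.sum_nonneg fun i _ => sq_nonneg _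
  have hb : 0 ≤ ∑ i, ‖(A *ᵥ v) i‖ ^ 2 := Finset.sum_nonneg fun i _ => sq_nonneg _
  have hma : m * ∑ i, ‖v i‖ ^ 2 ≤ ∑ i, ‖v i‖ * ‖(A *ᵥ v) i‖ := hacc.trans h2
  have hsq : (m * ∑ i, ‖v i‖ ^ 2) ^ 2 ≤ (∑ i, ‖v i‖ ^ 2) * ∑ i, ‖(A *ᵥ v) i‖ ^ 2 :=
    (pow_le_pow_left₀ (mul_nonneg hm ha) hma 2).trans h3
  rcases ha.eq_or_lt with ha0 | hapos
  · rw [← ha0, mul_zero]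
    exact hb
  · refine le_of_mul_le_mul_right ?_ hapos
    calc m ^ 2 * (∑ i, ‖v i‖ ^ 2) * ∑ i, ‖v i‖ ^ 2 = (m * ∑ i, ‖v i‖ ^ 2) ^ 2 := by ring
      _ ≤ (∑ i, ‖v i‖ ^ 2) * ∑ i, ‖(A *ᵥ v) i‖ ^ 2 := hsq
      _ = (∑ i, ‖(A *ᵥ v) i‖ ^ 2) * ∑ i, ‖v i‖ ^ 2 := mul_comm _ _

/-- **Coercive ⇒ spectral floor**: if `c Σ|v_i|² ≤ Σ |(A v)_i|²` for every `v`, then every eigenvalue of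
`H = AᴴA` is `≥ c` (`λ_k = Re⟨u_k, H u_k⟩ = ‖A u_k‖²` at the unit eigenvector `u_k`). -/
theorem le_eigenvalues_of_coercive (A : Matrix ι ι ℂ) (hH : (Aᴴ * A).IsHermitian) {c : ℝ}
    (hc : ∀ v : ι → ℂ, c * ∑ i, ‖v i‖ ^ 2 ≤ ∑ i, ‖(A *ᵥ v) i‖ ^ 2) (k : ι) :
    c ≤ hH.eigenvalues k := by
  set u : ι → ℂ := (hH.eigenvectorBasis k : ι → ℂ) with hu
  have hunit : ∑ i, ‖u i‖ ^ 2 = 1 := by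
    rw [hu, ← EuclideanSpace.norm_sq_eq, hH.eigenvectorBasis.orthonormal.1 k, one_pow]
  have hlam : hH.eigenvalues k = ∑ i, ‖(A *ᵥ u) i‖ ^ 2 := by
    rw [hH.eigenvalues_eq k, ← hu, ← Matrix.mulVec_mulVec, Matrix.dotProduct_mulVec,
      ← Matrix.star_mulVec, RCLike.re_to_complex, re_star_dotProduct_self]
  have h := hc u
  rw [hunit, mul_one, ← hlam] at h
  exact h

/-- **Entries of `exp(-t·AᴴA)` decay at the coercivity rate**: if `c Σ|v_i|² ≤ Σ |(A v)_i|²` for every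
`v`, then `|exp(-t·AᴴA)(i,j)| ≤ e^{-tc}` for `t ≥ 0` (`exp(-tAᴴA) = U diag(e^{-tλ}) U*` with `λ ≥ c`, then
`|Σ_k U_ik e^{-tλ_k} conj U_jk| ≤ e^{-tc} Σ_k |U_ik| |U_jk| ≤ e^{-tc}` by AM–GM and unit rows). -/
theorem norm_exp_neg_smul_apply_le_exp_of_coercive (A : Matrix ι ι ℂ) {c : ℝ}
    (hc : ∀ v : ι → ℂ, c * ∑ i, ‖v i‖ ^ 2 ≤ ∑ i, ‖(A *ᵥ v) i‖ ^ 2) {t : ℝ} (ht : 0 ≤ t) (i j : ι) :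
    ‖(NormedSpace.exp (-(t : ℂ) • (Aᴴ * A))) i j‖ ≤ Real.exp (-(t * c)) := by
  -- adapted from `norm_exp_neg_smul_conjTranspose_mul_self_apply_le_one` (Negative/LoadBearing)
  have hH : (Aᴴ * A).IsHermitian := (Matrix.posSemidef_conjTranspose_mul_self A).isHermitian
  obtain ⟨-, hexp⟩ := spectral_pair A hH t
  set U : Matrix ι ι ℂ := (hH.eigenvectorUnitary : Matrix ι ι ℂ) with hUdef
  have hUmem : U ∈ Matrix.unitaryGroup ι ℂ := hH.eigenvectorUnitary.2
  set w : ι → ℂ := fun k => ((Real.exp (-(t * hH.eigenvalues k)) : ℝ) : ℂ) with hw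
  have hentry : (U * Matrix.diagonal w * star U) i j = ∑ k, U i k * w k * star (U j k) := by
    rw [Matrix.mul_apply]
    refine Finset.sum_congr rfl fun k _ => ?_
    rw [Matrix.mul_diagonal, Matrix.star_apply]
  have hwle : ∀ k, ‖w k‖ ≤ Real.exp (-(t * c)) := by
    intro k
    rw [hw, Complex.norm_of_nonneg (Real.exp_pos _).le, Real.exp_le_exp, neg_le_neg_iff]
    exact mul_le_mul_of_nonneg_left (le_eigenvalues_of_coercive A hH hc k) ht
  rw [hexp, hentry]
  calc ‖∑ k, U i k * w k * star (U j k)‖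
      ≤ ∑ k, ‖U i k * w k * star (U j k)‖ := norm_sum_le _ _
    _ ≤ ∑ k, Real.exp (-(t * c)) * (‖U i k‖ * ‖U j k‖) := by
        refine Finset.sum_le_sum fun k _ => ?_
        rw [norm_mul, norm_mul, norm_star]
        calc ‖U i k‖ * ‖w k‖ * ‖U j k‖ ≤ ‖U i k‖ * Real.exp (-(t * c)) * ‖U j k‖ := by
              gcongr
              exact hwle k
          _ = Real.exp (-(t * c)) * (‖U i k‖ * ‖U j k‖) := by ring
    _ = Real.exp (-(t * c)) * ∑ k, ‖U i k‖ * ‖U j k‖ := by rw [Finset.mul_sum]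
    _ ≤ Real.exp (-(t * c)) * 1 := by
        refine mul_le_mul_of_nonneg_left ?_ (Real.exp_pos _).le
        calc ∑ k, ‖U i k‖ * ‖U j k‖ ≤ ∑ k, (‖U i k‖ ^ 2 + ‖U j k‖ ^ 2) / 2 := by
              refine Finset.sum_le_sum fun k _ => ?_
              have := two_mul_le_add_sq (‖U i k‖) (‖U j k‖)
              linarith
          _ = 1 := by
              rw [← Finset.sum_div, Finset.sum_add_distrib, unitary_row_norm_sq U hUmem i,
                unitary_row_norm_sq U hUmem j]
              norm_num
    _ = Real.exp (-(t * c)) := mul_one _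

end Generic

section Wilson

variable {L : ℕ} [NeZero L]

/-- **Coercivity of the Wilson–Dirac matrix for non-negative bare mass**: `m² Σ|v_i|² ≤ Σ |(D_W v)_i|²`
for `D_W = wilsonDirac (fundamentalRep (Fin 3)) U m 1`, `m ≥ 0` — from Wilson-term accretivity
`Re⟨v, D_W v⟩ = m‖v‖² + ½Σ‖U v(x+μ̂) − v(x)‖² ≥ m‖v‖²` (item stmt-QuantumFields-8875, `accretiveWilsonDirac_proof`)
and Cauchy–Schwarz. -/
theorem wilsonDirac_coercive (U : GaugeConfig 4 L (Matrix.specialUnitaryGroup (Fin 3) ℂ)) {m : ℝ}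
    (hm : 0 ≤ m) (v : TorusSite 4 L × Fin 3 × Fin 4 → ℂ) :
    m ^ 2 * ∑ i, ‖v i‖ ^ 2 ≤ ∑ i, ‖(wilsonDirac (fundamentalRep (Fin 3)) U m 1 *ᵥ v) i‖ ^ 2 := by
  refine sq_mul_sum_norm_sq_le_of_accretive _ hm v ?_
  rw [Summit.QuantumFields.QCD.Theorems.HeatSlicedQuarksAccretiveWilsonDirac.accretiveWilsonDirac_proof
    L U m v]
  exact le_add_of_nonneg_right (by positivity)

end Wilson

/-- **Infrared decay of the heat remainder** (registered stub `stub_infraredDecay` of line `Sketch`): for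
positive bare mass the heat remainder is exponentially small, `|e^{−T·D_WᴴD_W}(ξ,η)| ≤ e^{−Tm²}` (`T ≥ 0`,
`m > 0`, every `SU(3)` field) — accretivity `Re⟨v, D_W v⟩ ≥ m‖v‖²` (item 8875, PROVED) gives
`‖D_W v‖ ≥ m‖v‖`, i.e. `D_WᴴD_W ≥ m²`, hence every entry of `e^{−T·D_WᴴD_W} = U diag(e^{−Tλ}) U*` is bounded
by `e^{−Tm²}` (the infrared end of the slicing: positive masses stop the flow). -/
theorem stub_infraredDecay :
    ∀ (L : ℕ) [NeZero L] (U : GaugeConfig 4 L (Matrix.specialUnitaryGroup (Fin 3) ℂ)) (m : ℝ), 0 < m →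
      ∀ (T : ℝ), 0 ≤ T → ∀ (ξ η : TorusSite 4 L × Fin 3 × Fin 4),
        ‖(NormedSpace.exp (-(T : ℂ) • ((wilsonDirac (fundamentalRep (Fin 3)) U m 1)ᴴ *
            wilsonDirac (fundamentalRep (Fin 3)) U m 1))) ξ η‖ ≤ Real.exp (-(T * m ^ 2)) := by
  intro L _ U m hm T hT ξ η
  exact norm_exp_neg_smul_apply_le_exp_of_coercive _ (wilsonDirac_coercive U hm.le) hT ξ η

end Summit.QuantumFields.QCD.Cruxes.InterleavedHeatSliceFlow.Sketch

end
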